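import Summits.ABC.IUTFork.Cor312PilotKummerSplitThm311
import HarnessLib

/-!
# [IUTchIII] Cor. 3.12 — the ORBIT-EXCURSION bed P♮ₑ (honest graded split model), I: slabs, graded boxes, depths, the graded frame, the volume

Record-only file (D-0012; MODEL DATA, no `Prop` fact) of the abc-iut cell (IUT REPAIR branch B, sub-cell B4 Dupuy–Hilado, seat
abc-iut-rp-h3 gen 2; rung LADDER-ABC:A2.B). TAKES NO SIDE on [IUTchIII] Cor. 3.12 and no side between Mochizuki, Scholze–Stix, Joshi or
Dupuy–Hilado. By-name sequel of abc-iut-w5-d230's SPLIT bed P♮₁ (`Cor312PilotKummerSplitShells` / `…SplitModel` / `…SplitThm311`: the split index = TWO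
valuations over ONE place, split shells `ℚ`, the `2^{j+1}` coordinates `coord c` (`c : S^±_{j+1} → Bool`) of the `(j+1)`-tensor packet
`(ℚ²)^{⊗(j+1)}`, the action of ⟨(Ind1)∪(Ind2)⟩ by CAPSULE PERMUTATIONS `coord c (σ·x) = coord (c ∘ σ) x`), which are imported, not restated.

WHY A GRADED BED (part II `Cor312OrbitExcursionModel` carries the pilots / data / setting; parts III–IV the proofs). P♮₁ has TWO-LEVEL boxes
(deep / shallow) and the toy volume `−1 − #deep`; by its own scope note the Θ/q volume ratio there is `1`, not `j²`, the q-volume is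
label-dependent, and `S` HOLDS. The B4 question left open by abc-iut-rp-h3 gen 0 (memo `plan/repair/h3/RP-H30.md` §3 (iii) «MODEL-WANTED»;
kernel necessity `Repair.CandDupuyHilado32.orbit_excursion_of_statement`, p432805) asks for the opposite corner: a bed on which Dupuy–Hilado's
typed apparatus (explicit pilots from ONE Tate datum with HONEST `j²`-scaling and label-independent q-volume, shell-fixing isometric
indeterminacies, Θ-region a polydisc inside the log-shell) holds TOGETHER WITH the printed Statement — which, by the ∀-countermodel
(abc-iut-w5-d155 p419757), forces `¬S` and an (Ind1)/(Ind2)-orbit EXCURSION of the Θ-polydisc under a FINE frame. This file supplies the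
volume geometry of that bed:
* `slab c d` / `gbox k` — the slab `|coord c x|·2^d ≤ 1` and the GRADED BOX `{x | ∀ c, |coord c x|·2^{k c} ≤ 1}` with depth vector
  `k : (S^±_{j+1} → Bool) → ℕ` («`λ·𝒪` with `λ` of depth `k c` on the coordinate `c`»; rational «norms» standing in for `p`-adic balls);
  `image_gbox_of_perm`: a family acting by the capsule permutation `σ` carries `gbox k` ONTO `gbox (c ↦ k (c ∘ σ))`;
* `ePt c` — the elementary tensors, dual to the coordinates (`coord_ePt`), the witnesses of EXACT depth (`pow_smul_ePt_mem_slab_iff`);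
* `depthAt U c` — the largest `d ≤ K := 4` with `U ⊆ slab c d`; `depthAt_gbox`: a graded box of depth `≤ K` has EXACTLY its depth vector;
  `depthAt_image_of_perm`: depths are transported by precomposition;
* `excFrame` — c312-7's `HullFrame` with hull-sets ALL graded boxes of depth `≤ K` (a FINE polydisc frame): the least box containing a bounded
  `U` EXISTS and is `gbox (depthAt U)` (`excFrame_hull`; [IUTchIII] Rmk. 3.9.5 (i));
* `excVol` — the log-volume `−(Σ_c depthAt U c)/2^{j+1}` = minus the AVERAGE depth (Dupuy–Hilado's expectation `𝔼` over the `2^{j+1}` summands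
  `v⃗` of the packet, [cite: DupuyHilado2020, Def 3.6.3]); `excVol_gbox`.
HONEST SCOPE: interface-level toy (`l⋇ = 2`, one place); it models the MECHANISM «isometric, shell-fixing indeterminacies + fine polydisc frame ⟹
hull inflation» of [IUTchIV] Thm. 1.10 Step (v) / DH-II §6.2 (6.3)–(6.8), not [IUTchI] Def. 3.1 data. No judgement on print; no `Prop` fact;
standard axioms. [claim: Mochizuki2012, status: disputed] for every IUT noun. [cite: DupuyHilado2020, §4.7, §4.12, §6.2]
-/

noncomputable section

open Set

namespace Summit.ABC.IUTFork.Cor312Vol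

namespace ExcursionWitness

open Thm311 Cor312 Cor312.IdentifiedNonVacuity NaiveWitness PinnedWitness SplitWitness Literature.IUT.LogThetaLattice

/-! ## 1. Slabs and graded boxes on the split packets; their transport under capsule permutations -/

/-- The DEPTH CAP `K = 4` (`= (l⋇)²`, the deepest depth the pilots of P♮ₑ use): hull-sets have depths `≤ K`. [folklore] -/
def K : ℕ := 4

/-- The SLAB of depth `d` on the coordinate `c`: `|coord c x| · 2^d ≤ 1` («the `c`-component lies in `2^d·𝒪`»). [folklore] -/
def slab {j : splitIndex.Label} {vQ : splitIndex.VQ} (c : splitIndex.Caps j → Bool) (d : ℕ) : Set (splitShells.Packet j vQ) :=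
  {x | |coord j vQ c x| * (2 : ℚ) ^ d ≤ 1}

/-- The GRADED BOX with depth vector `k`: `|coord c x| · 2^{k c} ≤ 1` for every coordinate `c` — the «polydisc `λ·𝒪`» of P♮ₑ
([IUTchIII] Rmk. 3.9.5 (i) hull-sets; Dupuy–Hilado §4.12 «polydisc»). [claim: Mochizuki2012, status: disputed] -/
def gbox {j : splitIndex.Label} {vQ : splitIndex.VQ} (k : (splitIndex.Caps j → Bool) → ℕ) : Set (splitShells.Packet j vQ) :=
  {x | ∀ c, |coord j vQ c x| * (2 : ℚ) ^ (k c) ≤ 1}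

/-- `0` lies in every slab. [folklore] -/
theorem zero_mem_slab {j : splitIndex.Label} {vQ : splitIndex.VQ} (c : splitIndex.Caps j → Bool) (d : ℕ) :
    (0 : splitShells.Packet j vQ) ∈ slab c d := by
  show |coord j vQ c 0| * (2 : ℚ) ^ d ≤ 1
  rw [map_zero, abs_zero, zero_mul]; exact zero_le_one

/-- `0` lies in every graded box (hull-sets are nonempty). [folklore] -/
theorem zero_mem_gbox {j : splitIndex.Label} {vQ : splitIndex.VQ} (k : (splitIndex.Caps j → Bool) → ℕ) :
    (0 : splitShells.Packet j vQ) ∈ gbox k := fun c => zero_mem_slab c (k c)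

/-- Deeper slabs are smaller. [folklore] -/
theorem slab_antitone {j : splitIndex.Label} {vQ : splitIndex.VQ} (c : splitIndex.Caps j → Bool) {d d' : ℕ} (h : d ≤ d') :
    (slab c d' : Set (splitShells.Packet j vQ)) ⊆ slab c d := fun x hx =>
  le_trans (mul_le_mul_of_nonneg_left (pow_le_pow_right₀ (by norm_num : (1 : ℚ) ≤ 2) h) (abs_nonneg _)) hx

/-- A graded box lies in each of its slabs. [folklore] -/
theorem gbox_subset_slab {j : splitIndex.Label} {vQ : splitIndex.VQ} (k : (splitIndex.Caps j → Bool) → ℕ) (c : splitIndex.Caps j → Bool) :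
    (gbox k : Set (splitShells.Packet j vQ)) ⊆ slab c (k c) := fun _ hx => hx c

/-- Deeper boxes are smaller: `k ≤ k'` pointwise gives `gbox k' ⊆ gbox k`. [folklore] -/
theorem gbox_antitone {j : splitIndex.Label} {vQ : splitIndex.VQ} {k k' : (splitIndex.Caps j → Bool) → ℕ} (h : ∀ c, k c ≤ k' c) :
    (gbox k' : Set (splitShells.Packet j vQ)) ⊆ gbox k := fun _ hx c => slab_antitone c (h c) (hx c)

/-- `σ·U ⊆ slab c d ↔ U ⊆ slab (c ∘ σ) d` for a family acting by `σ` (coordinates are precomposed). [folklore] -/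
theorem image_subset_slab_iff {Φ : splitShells.PacketAut} {j : splitIndex.Label} {vQ : splitIndex.VQ} {σ : Equiv.Perm (splitIndex.Caps j)}
    (hΦ : ∀ x, Φ j vQ x = splitShells.permute j vQ σ x) (U : Set (splitShells.Packet j vQ)) (c : splitIndex.Caps j → Bool) (d : ℕ) :
    Φ j vQ '' U ⊆ slab c d ↔ U ⊆ slab (c ∘ ⇑σ) d := by
  constructor
  · intro h x hx
    have h1 := h ⟨x, hx, rfl⟩
    show |coord j vQ (c ∘ ⇑σ) x| * (2 : ℚ) ^ d ≤ 1
    rw [← coord_permute, ← hΦ]; exact h1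
  · rintro h _ ⟨x, hx, rfl⟩
    show |coord j vQ c (Φ j vQ x)| * (2 : ℚ) ^ d ≤ 1
    rw [hΦ, coord_permute]; exact h hx

/-- **A family acting by `σ` carries the graded box `gbox k` ONTO the graded box with depth `k (c ∘ σ)` at `c`** — graded boxes go to
graded boxes with PERMUTED depths (Dupuy–Hilado §4.7: (Ind1) «fixes the lattice ⊕𝓘» and permutes its polydiscs). [folklore] -/
theorem image_gbox_of_perm {Φ : splitShells.PacketAut} {j : splitIndex.Label} {vQ : splitIndex.VQ} {σ : Equiv.Perm (splitIndex.Caps j)}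
    (hΦ : ∀ x, Φ j vQ x = splitShells.permute j vQ σ x) (k : (splitIndex.Caps j → Bool) → ℕ) :
    Φ j vQ '' gbox k = gbox fun c => k (c ∘ ⇑σ) := by
  ext y
  constructor
  · rintro ⟨x, hx, rfl⟩ c
    rw [hΦ, coord_permute]; exact hx _
  · intro hy
    refine ⟨(Φ j vQ).symm y, fun c => ?_, LinearEquiv.apply_symm_apply _ _⟩
    rw [symm_apply_of_perm hΦ, coord_permute]
    have e : (c ∘ ⇑σ.symm) ∘ ⇑σ = c := funext fun i => by simp
    have h1 : |coord j vQ (c ∘ ⇑σ.symm) y| * (2 : ℚ) ^ k ((c ∘ ⇑σ.symm) ∘ ⇑σ) ≤ 1 := hy (c ∘ ⇑σ.symm)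
    rw [e] at h1; exact h1

/-! ## 2. Elementary tensors (witness points), the depth of a region, the graded hull frame, the log-volume -/

/-- The factors of the elementary tensor `e_c`: the `i`-th factor is the basis vector of the summand `c i`. [folklore] -/
def eFn (j : splitIndex.Label) (vQ : splitIndex.VQ) (c : splitIndex.Caps j → Bool) : splitIndex.Caps j → splitShells.Packet1 vQ :=
  fun i v => if v.1 = c i then 1 else 0

/-- The ELEMENTARY TENSOR `e_c = ⊗_i e_{c i}` of the packet (the `2^{j+1}` of them are dual to the coordinates `coord c`). [folklore] -/
def ePt (j : splitIndex.Label) (vQ : splitIndex.VQ) (c : splitIndex.Caps j → Bool) : splitShells.Packet j vQ :=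
  splitShells.tprod j vQ (eFn j vQ c)

/-- `coord c' (e_c) = δ_{c,c'}`. [folklore] -/
theorem coord_ePt {j : splitIndex.Label} (vQ : splitIndex.VQ) (c c' : splitIndex.Caps j → Bool) :
    coord j vQ c' (ePt j vQ c) = if c' = c then 1 else 0 := by
  unfold ePt LogShells.tprod
  rw [coord_tprod]
  have hf : ∀ i, eFn j vQ c i (fib vQ (c' i)) = if c' i = c i then (1 : ℚ) else 0 := fun i => rfl
  simp only [hf]
  by_cases h : c' = c
  · subst h; simp
  · obtain ⟨i, hi⟩ := Function.ne_iff.1 h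
    rw [if_neg h]
    exact Finset.prod_eq_zero (Finset.mem_univ i) (if_neg hi)

/-- `coord c' (t·e_c) = t·δ_{c,c'}`. [folklore] -/
theorem coord_smul_ePt {j : splitIndex.Label} (vQ : splitIndex.VQ) (t : ℚ) (c c' : splitIndex.Caps j → Bool) :
    coord j vQ c' (t • ePt j vQ c) = if c' = c then t else 0 := by
  rw [map_smul, coord_ePt, smul_eq_mul]; split_ifs <;> simp

/-- `t·e_c` lies in the slab of depth `d` on `c'` iff `c' ≠ c` or `|t|·2^d ≤ 1`. [folklore] -/
theorem smul_ePt_mem_slab_iff {j : splitIndex.Label} (vQ : splitIndex.VQ) (t : ℚ) (c c' : splitIndex.Caps j → Bool) (d : ℕ) :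
    t • ePt j vQ c ∈ (slab c' d : Set (splitShells.Packet j vQ)) ↔ (c' = c → |t| * (2 : ℚ) ^ d ≤ 1) := by
  show |coord j vQ c' (t • ePt j vQ c)| * (2 : ℚ) ^ d ≤ 1 ↔ _
  rw [coord_smul_ePt]
  by_cases h : c' = c
  · rw [if_pos h]; exact ⟨fun h1 _ => h1, fun h1 => h1 h⟩
  · rw [if_neg h, abs_zero, zero_mul]; exact ⟨fun _ h' => absurd h' h, fun _ => zero_le_one⟩

/-- `t·e_c ∈ gbox k ↔ |t|·2^{k c} ≤ 1` (the other coordinates vanish). [folklore] -/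
theorem smul_ePt_mem_gbox_iff {j : splitIndex.Label} (vQ : splitIndex.VQ) (t : ℚ) (c : splitIndex.Caps j → Bool)
    (k : (splitIndex.Caps j → Bool) → ℕ) : t • ePt j vQ c ∈ (gbox k : Set (splitShells.Packet j vQ)) ↔ |t| * (2 : ℚ) ^ (k c) ≤ 1 :=
  ⟨fun h => (smul_ePt_mem_slab_iff vQ t c c (k c)).1 (h c) rfl, fun h c' => (smul_ePt_mem_slab_iff vQ t c c' (k c')).2 fun e => by
    subst e; exact h⟩

/-- `2^{−d}·e_c` lies in the slab of depth `d'` on `c` iff `d' ≤ d` (the witness of EXACT depth). [folklore] -/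
theorem pow_smul_ePt_mem_slab_iff {j : splitIndex.Label} (vQ : splitIndex.VQ) (c : splitIndex.Caps j → Bool) (d d' : ℕ) :
    ((2 : ℚ)⁻¹ ^ d) • ePt j vQ c ∈ (slab c d' : Set (splitShells.Packet j vQ)) ↔ d' ≤ d := by
  rw [smul_ePt_mem_slab_iff]
  have h2 : (0 : ℚ) < 2 ^ d := by positivity
  rw [abs_of_nonneg (by positivity), inv_pow, inv_mul_le_iff₀ h2, mul_one]
  constructor
  · intro h
    exact (pow_le_pow_iff_right₀ (by norm_num : (1 : ℚ) < 2)).1 (h rfl)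
  · intro h _
    exact pow_le_pow_right₀ (by norm_num) h

open scoped Classical in
/-- The DEPTH of a region on the coordinate `c`: the largest `d ≤ K` with `U ⊆ slab c d` (so the least graded box containing a bounded
`U` is `gbox (depthAt U)`). [folklore] -/
def depthAt {j : splitIndex.Label} {vQ : splitIndex.VQ} (U : Set (splitShells.Packet j vQ)) (c : splitIndex.Caps j → Bool) : ℕ :=
  Nat.findGreatest (fun d => U ⊆ slab c d) K

/-- Depths are capped by `K`. [folklore] -/
theorem depthAt_le_K {j : splitIndex.Label} {vQ : splitIndex.VQ} (U : Set (splitShells.Packet j vQ)) (c : splitIndex.Caps j → Bool) :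
    depthAt U c ≤ K := by
  classical
  exact Nat.findGreatest_le K

/-- A slab of depth `d ≤ K` containing `U` bounds the depth from below. [folklore] -/
theorem le_depthAt {j : splitIndex.Label} {vQ : splitIndex.VQ} {U : Set (splitShells.Packet j vQ)} {c : splitIndex.Caps j → Bool} {d : ℕ}
    (h : U ⊆ slab c d) (hd : d ≤ K) : d ≤ depthAt U c := by
  classical
  exact Nat.le_findGreatest hd h

/-- If `U` escapes the slab of depth `d + 1`, its depth is at most `d` (slabs are nested). [folklore] -/
theorem depthAt_le_of_not_subset {j : splitIndex.Label} {vQ : splitIndex.VQ} {U : Set (splitShells.Packet j vQ)}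
    {c : splitIndex.Caps j → Bool} {d : ℕ} (h : ¬ U ⊆ slab c (d + 1)) : depthAt U c ≤ d := by
  classical
  by_contra hlt
  have hlt' : d + 1 ≤ depthAt U c := by omega
  have hne : depthAt U c ≠ 0 := by omega
  have hP : U ⊆ slab c (depthAt U c) :=
    Nat.findGreatest_of_ne_zero (P := fun d => U ⊆ slab c d) (n := K) (m := depthAt U c) rfl hne
  exact h (hP.trans (slab_antitone c hlt'))

/-- EXACT depth: inside the slab of depth `d ≤ K`, outside the next one. [folklore] -/
theorem depthAt_eq {j : splitIndex.Label} {vQ : splitIndex.VQ} {U : Set (splitShells.Packet j vQ)} {c : splitIndex.Caps j → Bool} {d : ℕ}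
    (h : U ⊆ slab c d) (hd : d ≤ K) (hn : ¬ U ⊆ slab c (d + 1)) : depthAt U c = d :=
  le_antisymm (depthAt_le_of_not_subset hn) (le_depthAt h hd)

/-- A bounded region (inside the unit box `gbox 0`) lies in the slab of its depth on every coordinate … [folklore] -/
theorem subset_slab_depthAt {j : splitIndex.Label} {vQ : splitIndex.VQ} {U : Set (splitShells.Packet j vQ)} (hU : U ⊆ gbox 0)
    (c : splitIndex.Caps j → Bool) : U ⊆ slab c (depthAt U c) := by
  classical
  exact Nat.findGreatest_spec (P := fun d => U ⊆ slab c d) (Nat.zero_le K) (hU.trans (gbox_subset_slab 0 c))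

/-- … hence in the graded box of its depth vector. [folklore] -/
theorem subset_gbox_depthAt {j : splitIndex.Label} {vQ : splitIndex.VQ} {U : Set (splitShells.Packet j vQ)} (hU : U ⊆ gbox 0) :
    U ⊆ gbox (depthAt U) := fun _ hx c => subset_slab_depthAt hU c hx

/-- The box of the depth vector is the LEAST hull-box containing `U`. [folklore] -/
theorem gbox_depthAt_subset {j : splitIndex.Label} {vQ : splitIndex.VQ} {U : Set (splitShells.Packet j vQ)}
    {k : (splitIndex.Caps j → Bool) → ℕ} (h : U ⊆ gbox k) (hk : ∀ c, k c ≤ K) : (gbox (depthAt U) : Set (splitShells.Packet j vQ)) ⊆ gbox k :=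
  gbox_antitone fun c => le_depthAt (h.trans (gbox_subset_slab k c)) (hk c)

/-- The depth is antitone in the region. [folklore] -/
theorem depthAt_antitone {j : splitIndex.Label} {vQ : splitIndex.VQ} {U U' : Set (splitShells.Packet j vQ)} (h : U ⊆ U')
    (c : splitIndex.Caps j → Bool) : depthAt U' c ≤ depthAt U c := by
  classical
  unfold depthAt
  exact Nat.findGreatest_mono_left (fun d hd => h.trans hd) K

/-- Regions lying in the same slabs have the same depth (used for transport under capsule permutations). [folklore] -/
theorem depthAt_congr {j j' : splitIndex.Label} {vQ vQ' : splitIndex.VQ} {U : Set (splitShells.Packet j vQ)}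
    {U' : Set (splitShells.Packet j' vQ')} {c : splitIndex.Caps j → Bool} {c' : splitIndex.Caps j' → Bool}
    (h : ∀ d, U ⊆ slab c d ↔ U' ⊆ slab c' d) : depthAt U c = depthAt U' c' := by
  classical
  unfold depthAt
  exact le_antisymm (Nat.findGreatest_mono_left (fun d hd => (h d).1 hd) K) (Nat.findGreatest_mono_left (fun d hd => (h d).2 hd) K)

/-- **The depth vector of a graded box with depths `≤ K` is its depth vector** (the witness `2^{−k c}·e_c` separates). [folklore] -/
theorem depthAt_gbox {j : splitIndex.Label} (vQ : splitIndex.VQ) {k : (splitIndex.Caps j → Bool) → ℕ} (hk : ∀ c, k c ≤ K)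
    (c : splitIndex.Caps j → Bool) : depthAt (gbox k : Set (splitShells.Packet j vQ)) c = k c := by
  refine depthAt_eq (gbox_subset_slab k c) (hk c) fun h => ?_
  have ht : |(2 : ℚ)⁻¹ ^ k c| * (2 : ℚ) ^ (k c) ≤ 1 :=
    (smul_ePt_mem_slab_iff vQ _ c c (k c)).1 ((pow_smul_ePt_mem_slab_iff vQ c (k c) (k c)).2 le_rfl) rfl
  have hw : ((2 : ℚ)⁻¹ ^ k c) • ePt j vQ c ∈ (gbox k : Set (splitShells.Packet j vQ)) := (smul_ePt_mem_gbox_iff vQ _ c k).2 ht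
  have h2 : k c + 1 ≤ k c := (pow_smul_ePt_mem_slab_iff vQ c (k c) (k c + 1)).1 (h hw)
  omega

/-- Depths transported: `depthAt (σ·U) c = depthAt U (c ∘ σ)`. [folklore] -/
theorem depthAt_image_of_perm {Φ : splitShells.PacketAut} {j : splitIndex.Label} {vQ : splitIndex.VQ} {σ : Equiv.Perm (splitIndex.Caps j)}
    (hΦ : ∀ x, Φ j vQ x = splitShells.permute j vQ σ x) (U : Set (splitShells.Packet j vQ)) (c : splitIndex.Caps j → Bool) :
    depthAt (Φ j vQ '' U) c = depthAt U (c ∘ ⇑σ) :=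
  depthAt_congr fun d => image_subset_slab_iff hΦ U c d

/-- The HULL-SETS of P♮ₑ: the graded boxes of depth `≤ K`. [folklore] -/
def excHul (j : splitIndex.Label) (vQ : splitIndex.VQ) : Set (Set (splitShells.Packet j vQ)) :=
  {B | ∃ k : (splitIndex.Caps j → Bool) → ℕ, (∀ c, k c ≤ K) ∧ B = gbox k}

/-- A graded box of depth `≤ K` is a hull-set. [folklore] -/
theorem gbox_mem_excHul {j : splitIndex.Label} (vQ : splitIndex.VQ) {k : (splitIndex.Caps j → Bool) → ℕ} (hk : ∀ c, k c ≤ K) :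
    gbox k ∈ excHul j vQ := ⟨k, hk, rfl⟩

/-- **The GRADED HULL FRAME of P♮ₑ** (a FINE frame: every polydisc of depth `≤ K` is a hull-set): relatively compact = inside the unit box,
every bounded region admits its hull = the graded box of its depth vector ([IUTchIII] Rmk. 3.9.5 (i) «the smallest subset of the form
`λ·𝒪` that contains `U`»). [folklore] -/
def excFrame (j : splitIndex.Label) (vQ : splitIndex.VQ) : HullFrame (splitShells.Packet j vQ) where
  Hul := excHul j vQ
  IsBounded := fun U => U ⊆ gbox 0
  HasHull := fun _ => True
  hul_bounded := fun _ hH => by obtain ⟨k, -, rfl⟩ := hH; exact gbox_antitone fun c => Nat.zero_le _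
  bounded_mono := fun _ _ h h' => h.trans h'
  exists_hul := fun U hU => ⟨gbox 0, ⟨0, fun _ => Nat.zero_le _, rfl⟩, hU⟩
  hull_mem := fun U hU _ => by
    rw [sInter_eq_of_least (S := {H | H ∈ excHul j vQ ∧ U ⊆ H}) (H₀ := gbox (depthAt U))
      ⟨gbox_mem_excHul vQ (depthAt_le_K U), subset_gbox_depthAt hU⟩
      fun H hH => by obtain ⟨⟨k, hk, rfl⟩, hUH⟩ := hH; exact gbox_depthAt_subset hUH hk]
    exact gbox_mem_excHul vQ (depthAt_le_K U)

/-- In the graded frame the holomorphic hull of a bounded region is the graded box of its depth vector. [folklore] -/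
theorem excFrame_hull {j : splitIndex.Label} {vQ : splitIndex.VQ} {U : Set (splitShells.Packet j vQ)} (hU : U ⊆ gbox 0) :
    (excFrame j vQ).hull U = gbox (depthAt U) := by
  unfold HullFrame.hull
  rw [if_pos (show (excFrame j vQ).IsBounded U from hU)]
  exact sInter_eq_of_least (S := {H | H ∈ excHul j vQ ∧ U ⊆ H}) ⟨gbox_mem_excHul vQ (depthAt_le_K U), subset_gbox_depthAt hU⟩
    fun H hH => by obtain ⟨⟨k, hk, rfl⟩, hUH⟩ := hH; exact gbox_depthAt_subset hUH hk

open scoped Classical in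
/-- **The LOG-VOLUME of P♮ₑ**: minus the AVERAGE depth `−(Σ_c depthAt U c)/2^{j+1}` on bounded regions (Dupuy–Hilado's normalized
log-measure = expectation over the `2^{j+1}` summands `v⃗` of the tensor packet), `0` elsewhere. Monotone; invariant under capsule
permutations (part II). [claim: Mochizuki2012, status: disputed] -/
def excVol (j : splitIndex.Label) (vQ : splitIndex.VQ) (U : Set (splitShells.Packet j vQ)) : ℝ :=
  if U ⊆ gbox 0 then -(∑ c, (depthAt U c : ℝ)) / 2 ^ ((j : ℕ) + 1) else 0

/-- The log-volume of a graded box of depth `≤ K` is minus its average depth. [folklore] -/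
theorem excVol_gbox {j : splitIndex.Label} (vQ : splitIndex.VQ) {k : (splitIndex.Caps j → Bool) → ℕ} (hk : ∀ c, k c ≤ K) :
    excVol j vQ (gbox k) = -(∑ c, (k c : ℝ)) / 2 ^ ((j : ℕ) + 1) := by
  unfold excVol
  rw [if_pos (show (gbox k : Set (splitShells.Packet j vQ)) ⊆ gbox 0 from gbox_antitone fun c => Nat.zero_le _)]
  simp only [depthAt_gbox vQ hk]

end ExcursionWitness

end Summit.ABC.IUTFork.Cor312Vol

end
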